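import Summits.QuantumFields.YangMills.Theses.SmallCircleAnchor
import Literature.MathematicalPhysics.QuantumLattice.LatticeGaugeDLRProofs

/-!
# Static (axial) gauge for the finite-temperature lattice: shear maps preserve product Haar

Helpers for crux stmt-QuantumFields-11141 (`AnchorGap`, route `SmallCircleAnchor`), line
independent — the first step of every treatment of the pinned finite-temperature Wilson theory
(static / axial / Polyakov gauge): for a GAUGE-INVARIANT integrand one may set every time-like
link outside the top time layer to `1`, the top layer then carrying the Polyakov-line holonomy
as an independent Haar-distributed site variable.

* `measurePreserving_shear` (abstract): on a finite product `ι → G` of copies of a compact group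
  with its two-sided invariant probability measure, the "shear" that multiplies the coordinates
  in a set `S` on the left and on the right by factors depending only on the coordinates OUTSIDE
  `S` preserves the product measure (Fubini + translation invariance, via
  `MeasurePreserving.skew_product`).
* `static_gauge_integral` (crux vocabulary, registered sub-goal): for every measurable
  gauge-invariant `Φ`, `∫ Φ dν = ∫ Φ ∘ kill dν`, where `kill U` replaces the time-like links
  `((t, x), none)` with `t ≠ -1` by `1`.

Reference: K. Osterwalder, E. Seiler, Ann. Phys. 110 (1978) 440, §3 (temporal gauge);
C. Borgs, E. Seiler, Comm. Math. Phys. 91 (1983) 329, §II.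
-/

set_option autoImplicit false

noncomputable section

namespace Summit.QuantumFields.YangMills.Theorems.AnchorGap

open MeasureTheory

namespace StaticGauge

/-! ### Shear maps on finite products of a group with a two-sided invariant measure -/

section Shear

variable {ι : Type*} [Fintype ι] {G : Type*} [Group G] [MeasurableSpace G]
variable (μ : Measure G) [IsProbabilityMeasure μ]
  (hμ : ∀ c d : G, MeasurePreserving (fun x : G => c * x * d) μ μ)

include hμ in
/-- **Two-sided translation of every coordinate preserves the product measure**: if `μ` is
invariant under all two-sided translations `x ↦ c x d`, then for fixed families `c d : ι → G`,
`v ↦ (i ↦ c i * v i * d i)` preserves `μ^{⊗ ι}`. [folklore] -/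
theorem measurePreserving_mul_mul_pi (c d : ι → G) :
    MeasurePreserving (fun (v : ι → G) (i : ι) => c i * v i * d i)
      (Measure.pi fun _ => μ) (Measure.pi fun _ => μ) :=
  measurePreserving_pi (fun _ => μ) (fun _ => μ) (f := fun i x => c i * x * d i) fun i => hμ (c i) (d i)

include hμ in
/-- **Shear maps preserve the product measure.** Let `p` select a set of coordinates and let the
factor families `a U`, `b U` depend only on the coordinates of `U` where `p` fails. Then
`U ↦ (i ↦ if p i then a U i * U i * b U i else U i)` preserves `μ^{⊗ ι}` (`μ` a probability
measure invariant under left and right translations). Proof: split `ι → G` as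
`(p-part) × (¬p-part)` (`measurePreserving_piEquivPiSubtypeProd`); in these coordinates the map
is a skew product over the identity of the `¬p`-part whose fibre maps are two-sided coordinate
translations (`measurePreserving_mul_mul_pi`), so `MeasurePreserving.skew_product` applies.
[folklore] -/
theorem measurePreserving_shear [MeasurableMul₂ G] (p : ι → Prop) [DecidablePred p]
    (a b : (ι → G) → ι → G) (ha : Measurable a) (hb : Measurable b)
    (hdep : ∀ U U' : ι → G, (∀ i, ¬ p i → U i = U' i) → a U = a U' ∧ b U = b U') :
    MeasurePreserving (fun (U : ι → G) (i : ι) => if p i then a U i * U i * b U i else U i)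
      (Measure.pi fun _ => μ) (Measure.pi fun _ => μ) := by
  classical
  set e := MeasurableEquiv.piEquivPiSubtypeProd (fun _ : ι => G) p with he_def
  have he : MeasurePreserving e (Measure.pi fun _ => μ)
      ((Measure.pi fun _ : Subtype p => μ).prod (Measure.pi fun _ : {i // ¬ p i} => μ)) :=
    measurePreserving_piEquivPiSubtypeProd (fun _ : ι => μ) p
  -- the completion of the `¬p`-coordinates by `1` on the `p`-coordinates
  let fill : ({i // ¬ p i} → G) → ι → G := fun w => e.symm (fun _ => 1, w)
  have hfill : Measurable fill :=
    e.symm.measurable.comp (measurable_const.prodMk measurable_id)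
  -- fibre maps
  let Tm : ({i // ¬ p i} → G) → (Subtype p → G) → Subtype p → G :=
    fun w v j => a (fill w) j * v j * b (fill w) j
  have hTm : Measurable (Function.uncurry Tm) := by
    refine measurable_pi_lambda _ fun j => ?_
    have h1 : Measurable fun q : ({i // ¬ p i} → G) × (Subtype p → G) => a (fill q.1) (j : ι) :=
      (measurable_pi_apply (j : ι)).comp (ha.comp (hfill.comp measurable_fst))
    have h2 : Measurable fun q : ({i // ¬ p i} → G) × (Subtype p → G) => q.2 j :=
      (measurable_pi_apply j).comp measurable_snd
    have h3 : Measurable fun q : ({i // ¬ p i} → G) × (Subtype p → G) => b (fill q.1) (j : ι) :=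
      (measurable_pi_apply (j : ι)).comp (hb.comp (hfill.comp measurable_fst))
    exact (h1.mul h2).mul h3
  have hskew : MeasurePreserving (fun q : ({i // ¬ p i} → G) × (Subtype p → G) => (q.1, Tm q.1 q.2))
      ((Measure.pi fun _ : {i // ¬ p i} => μ).prod (Measure.pi fun _ : Subtype p => μ))
      ((Measure.pi fun _ : {i // ¬ p i} => μ).prod (Measure.pi fun _ : Subtype p => μ)) := by
    refine (MeasurePreserving.id _).skew_product hTm (ae_of_all _ fun w => ?_)
    exact (measurePreserving_mul_mul_pi μ hμ (fun j : Subtype p => a (fill w) j)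
      (fun j : Subtype p => b (fill w) j)).map_eq
  have hcomp : MeasurePreserving
      (e.symm ∘ Prod.swap ∘ (fun q : ({i // ¬ p i} → G) × (Subtype p → G) => (q.1, Tm q.1 q.2)) ∘
        Prod.swap ∘ e) (Measure.pi fun _ => μ) (Measure.pi fun _ => μ) :=
    (((he.symm.comp Measure.measurePreserving_swap).comp hskew).comp Measure.measurePreserving_swap).comp he
  convert hcomp using 1
  funext U
  funext i
  simp only [Function.comp_apply, Prod.swap_prod_mk]
  have hagree : ∀ i, ¬ p i → U i = fill (e U).2 i := by
    intro i hi
    simp [fill, he_def, MeasurableEquiv.piEquivPiSubtypeProd, Equiv.piEquivPiSubtypeProd, hi]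
  obtain ⟨hau, hbu⟩ := hdep U (fill (e U).2) hagree
  by_cases hi : p i
  · simp only [he_def, MeasurableEquiv.piEquivPiSubtypeProd, MeasurableEquiv.coe_mk,
      MeasurableEquiv.symm_mk, Equiv.piEquivPiSubtypeProd, Equiv.coe_fn_mk, Equiv.coe_fn_symm_mk,
      hi, dite_true, if_true]
    rw [hau, hbu]
    rfl
  · simp [he_def, MeasurableEquiv.piEquivPiSubtypeProd, Equiv.piEquivPiSubtypeProd, hi]

end Shear

/-! ### Change of variables along a measure-preserving self-map -/

/-- `∫ g ∘ Θ dν = ∫ g dν` for a measure-preserving self-map `Θ` and measurable real `g`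
(no integrability needed: both sides are the same Bochner integral after `map Θ ν = ν`).
[folklore] -/
theorem integral_comp_eq_of_measurePreserving {Ω : Type*} [MeasurableSpace Ω] {ν : Measure Ω}
    {Θ : Ω → Ω} (hΘ : MeasurePreserving Θ ν ν) {g : Ω → ℝ} (hg : Measurable g) :
    ∫ x, g (Θ x) ∂ν = ∫ x, g x ∂ν := by
  have h := integral_map (μ := ν) hΘ.measurable.aemeasurable (f := g)
    (by rw [hΘ.map_eq]; exact hg.aestronglyMeasurable)
  rw [hΘ.map_eq] at h
  exact h.symm

/-! ### The static gauge on `ℤ_T × (ℤ/L)³` -/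

section Static

open Literature.MathematicalPhysics.QuantumFieldTheory

/-- **Static gauge** (crux `AnchorGap` vocabulary, registered sub-goal). On the
finite-temperature lattice `ℤ_T × (ℤ/L)³` with product Haar probability measure `ν` on the link
variables, for every measurable GAUGE-INVARIANT integrand `Φ` one may replace every time-like
link `((t, x), none)` outside the top layer `t = -1` by `1`:
`∫ Φ dν = ∫ Φ (kill U) dν(U)`. Proof: pointwise `Φ U = Φ (h_U • U)` for the axial gauge
transformation `h_U(t, x) = U((0,x),none) ⋯ U((t-1,x),none)`; the gauge-fixed field has lower
time-links `1`, top time-links `h_U(T-1,x) U((T-1,x),none)` and spatial links conjugated by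
`h_U`; two shears (`measurePreserving_shear`: spatial links two-sidedly translated by factors
depending on time-links only; top time-links left-translated by factors depending on lower
time-links only) bring it to `kill U` without changing the integral. [folklore] -/
theorem static_gauge_integral :
    ∀ (G : Type) [Group G] [TopologicalSpace G] [IsTopologicalGroup G] [CompactSpace G] [SecondCountableTopology G], letI : MeasurableSpace G := borel G; haveI : BorelSpace G := ⟨rfl⟩; ∀ (T : ℕ) [NeZero T] (L : ℕ) [NeZero L], let St := ZMod T × (Fin 3 → ZMod L); let Cfg := St × Option (Fin 3) → G; let ν : MeasureTheory.Measure Cfg := MeasureTheory.Measure.pi fun _ => haarProbability G; let sh : St → Option (Fin 3) → St := fun x μ => Option.elim μ (x.1 + 1, x.2) fun i => (x.1, x.2 + Pi.single i 1); let gauge : (St → G) → Cfg → Cfg := fun h U p => h p.1 * U p * (h (sh p.1 p.2))⁻¹; let kill : Cfg → Cfg := fun U p => if p.2 = none ∧ p.1.1 + 1 ≠ 0 then 1 else U p; ∀ Φ : Cfg → ℝ, Measurable Φ → (∀ (h : St → G) (U : Cfg), Φ (gauge h U) = Φ U) → ∫ U, Φ U ∂ν = ∫ U, Φ (kill U) ∂ν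 := by
  intro G _ _ _ _ _
  letI : MeasurableSpace G := borel G
  haveI : BorelSpace G := ⟨rfl⟩
  intro T _ L _ St Cfg ν sh gauge kill Φ hΦm hΦg
  haveI : IsProbabilityMeasure (haarProbability G) := inferInstance
  -- partial Polyakov products `U((0,y),none) ⋯ U((n-1,y),none)` and their basic properties
  let pp : Cfg → (Fin 3 → ZMod L) → ℕ → G := fun U y n =>
    (List.ofFn fun s : Fin n => U ((((s : ℕ) : ZMod T), y), none)).prod
  have pp_zero : ∀ (U : Cfg) (y : Fin 3 → ZMod L), pp U y 0 = 1 := by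
    intro U y; simp [pp]
  have pp_succ : ∀ (U : Cfg) (y : Fin 3 → ZMod L) (n : ℕ),
      pp U y (n + 1) = pp U y n * U ((((n : ℕ) : ZMod T), y), none) := by
    intro U y n
    simp only [pp]
    rw [List.ofFn_succ', List.concat_eq_append, List.prod_append, List.prod_singleton]
    simp
  have pp_congr : ∀ (U U' : Cfg) (y : Fin 3 → ZMod L) (n : ℕ),
      (∀ s : ℕ, s < n → U ((((s : ℕ) : ZMod T), y), none) = U' ((((s : ℕ) : ZMod T), y), none)) →
      pp U y n = pp U' y n := by
    intro U U' y n
    induction n with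
    | zero => intro _; rw [pp_zero, pp_zero]
    | succ n ih =>
      intro h
      rw [pp_succ, pp_succ, ih (fun s hs => h s (Nat.lt_succ_of_lt hs)), h n (Nat.lt_succ_self n)]
  have continuous_pp : ∀ (y : Fin 3 → ZMod L) (n : ℕ), Continuous fun U : Cfg => pp U y n := by
    intro y n
    induction n with
    | zero => simp only [pp_zero]; exact continuous_const
    | succ n ih => simp only [pp_succ]; exact ih.mul (continuous_apply _)
  -- axial gauge transformation and the three auxiliary maps
  let ax : Cfg → St → G := fun U x => pp U x.2 x.1.val
  let asp : Cfg → (St × Option (Fin 3)) → G := fun U p => ax U p.1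
  let bsp : Cfg → (St × Option (Fin 3)) → G := fun U p => (ax U (sh p.1 p.2))⁻¹
  let Θsp : Cfg → Cfg := fun U p => if p.2 ≠ none then asp U p * U p * bsp U p else U p
  let btop : Cfg → (St × Option (Fin 3)) → G := fun _ _ => 1
  let Θtop : Cfg → Cfg := fun U p =>
    if p.2 = none ∧ p.1.1 + 1 = 0 then asp U p * U p * btop U p else U p
  let K₁ : Cfg → Cfg := fun U p =>
    if p.2 = none then (if p.1.1 + 1 ≠ 0 then 1 else ax U p.1 * U p) else U p
  -- basic facts about `ax`
  have hax_time : ∀ U U' : Cfg, (∀ q : St × Option (Fin 3), q.2 = none → U q = U' q) →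
      ax U = ax U' := by
    intro U U' h
    funext x
    exact pp_congr U U' x.2 x.1.val fun s _ => h _ rfl
  have hax_zero : ∀ (U : Cfg) (y : Fin 3 → ZMod L), ax U ((0 : ZMod T), y) = 1 := by
    intro U y
    show pp U y (0 : ZMod T).val = 1
    rw [ZMod.val_zero, pp_zero]
  have hax_step : ∀ (U : Cfg) (t : ZMod T) (y : Fin 3 → ZMod L), t + 1 ≠ 0 →
      ax U (t + 1, y) = ax U (t, y) * U ((t, y), none) := by
    intro U t y ht
    have hlt : t.val + 1 < T := by
      rcases Nat.lt_or_ge (t.val + 1) T with h | h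
      · exact h
      · exfalso
        apply ht
        have htv : t.val = T - 1 := by
          have := ZMod.val_lt t
          omega
        have h0 : t = ((T - 1 : ℕ) : ZMod T) := by
          rw [← htv, ZMod.natCast_zmod_val]
        have h1 : ((T - 1 : ℕ) : ZMod T) + 1 = 0 := by
          have h2 : ((T - 1 : ℕ) : ZMod T) + 1 = ((T - 1 + 1 : ℕ) : ZMod T) := by push_cast; ring
          rw [h2, Nat.sub_add_cancel NeZero.one_le, ZMod.natCast_self]
        rw [h0]; exact h1
    have hT1 : (1 : ZMod T).val = 1 := by
      rw [ZMod.val_one_eq_one_mod]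
      exact Nat.mod_eq_of_lt (by omega)
    have hval : (t + 1).val = t.val + 1 := by
      rw [ZMod.val_add_of_lt (by rw [hT1]; exact hlt), hT1]
    show pp U y (t + 1).val = pp U y t.val * U ((t, y), none)
    rw [hval, pp_succ, ZMod.natCast_zmod_val]
  have hax_lower : ∀ U U' : Cfg,
      (∀ q : St × Option (Fin 3), q.2 = none → q.1.1 + 1 ≠ 0 → U q = U' q) → ax U = ax U' := by
    intro U U' h
    funext x
    refine pp_congr U U' x.2 x.1.val fun s hs => h _ rfl ?_
    intro h0
    have h1 : ((s : ℕ) : ZMod T) + 1 = ((s + 1 : ℕ) : ZMod T) := by push_cast; ring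
    rw [h1, ZMod.natCast_eq_zero_iff] at h0
    have h2 : s + 1 < T := lt_of_le_of_lt (Nat.succ_le_of_lt hs) (ZMod.val_lt x.1)
    exact absurd (Nat.eq_zero_of_dvd_of_lt h0 h2) (Nat.succ_ne_zero s)
  -- (2) the gauge-fixed field is `K₁ ∘ Θsp`
  have h2 : ∀ U : Cfg, gauge (ax U) U = K₁ (Θsp U) := by
    intro U
    have haxΘ : ax (Θsp U) = ax U :=
      hax_time _ _ fun q hq => by simp [Θsp, hq]
    funext p
    obtain ⟨⟨t, y⟩, μ⟩ := p
    cases μ with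
    | none =>
      by_cases ht : t + 1 = 0
      · show ax U (t, y) * U ((t, y), none) * (ax U (t + 1, y))⁻¹ = K₁ (Θsp U) ((t, y), none)
        simp only [K₁, haxΘ, ht, if_true, Ne, not_true_eq_false, if_false]
        rw [hax_zero, inv_one, mul_one]
        simp [Θsp]
      · show ax U (t, y) * U ((t, y), none) * (ax U (t + 1, y))⁻¹ = K₁ (Θsp U) ((t, y), none)
        rw [hax_step U t y ht, mul_inv_cancel]
        simp [K₁, ht]
    | some i =>
      show ax U (t, y) * U ((t, y), some i) * (ax U (sh (t, y) (some i)))⁻¹ =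
        K₁ (Θsp U) ((t, y), some i)
      simp [K₁, Θsp, asp, bsp]
  -- (3) `K₁ = kill ∘ Θtop`
  have h3 : ∀ U : Cfg, K₁ U = kill (Θtop U) := by
    intro U
    funext p
    obtain ⟨⟨t, y⟩, μ⟩ := p
    cases μ with
    | none =>
      by_cases ht : t + 1 = 0
      · simp [K₁, kill, Θtop, asp, btop, ht]
      · simp [K₁, kill, Θtop, ht]
    | some i => simp [K₁, kill, Θtop]
  -- (4) measurability and measure preservation
  have hμ : ∀ c d : G, MeasurePreserving (fun x : G => c * x * d) (haarProbability G)
      (haarProbability G) := fun c d => by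
    simpa using
      Literature.MathematicalPhysics.QuantumLattice.measurePreserving_mul_mul_inv_haarProbability c d⁻¹
  have hasp : Measurable asp :=
    measurable_pi_lambda _ fun p => (continuous_pp p.1.2 p.1.1.val).measurable
  have hbsp : Measurable bsp :=
    measurable_pi_lambda _ fun p => (continuous_pp (sh p.1 p.2).2 (sh p.1 p.2).1.val).inv.measurable
  have hbtop : Measurable btop := measurable_const
  have hΘsp : MeasurePreserving Θsp ν ν := by
    refine measurePreserving_shear (haarProbability G) hμ (fun p : St × Option (Fin 3) => p.2 ≠ none)
      asp bsp hasp hbsp fun U U' h => ?_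
    have hax := hax_time U U' fun q hq => h q (by simpa using hq)
    exact ⟨funext fun p => by simp [asp, hax], funext fun p => by simp [bsp, hax]⟩
  have hΘtop : MeasurePreserving Θtop ν ν := by
    refine measurePreserving_shear (haarProbability G) hμ
      (fun p : St × Option (Fin 3) => p.2 = none ∧ p.1.1 + 1 = 0) asp btop hasp hbtop fun U U' h => ?_
    have hax := hax_lower U U' fun q hq hq' => h q (by simp [hq'])
    exact ⟨funext fun p => by simp [asp, hax], rfl⟩
  have hK₁m : Measurable K₁ := by
    refine measurable_pi_lambda _ fun p => ?_
    by_cases hp : p.2 = none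
    · by_cases hp' : p.1.1 + 1 ≠ 0
      · simp only [K₁, if_pos hp, if_pos hp']
        exact measurable_const
      · simp only [K₁, if_pos hp, if_neg hp']
        exact ((continuous_pp p.1.2 p.1.1.val).mul (continuous_apply p)).measurable
    · simp only [K₁, if_neg hp]
      exact measurable_pi_apply p
  have hkillm : Measurable kill := by
    refine measurable_pi_lambda _ fun p => ?_
    by_cases hp : p.2 = none ∧ p.1.1 + 1 ≠ 0
    · simp only [kill, if_pos hp]
      exact measurable_const
    · simp only [kill, if_neg hp]
      exact measurable_pi_apply p
  -- (5) assemble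
  calc ∫ U, Φ U ∂ν = ∫ U, (Φ ∘ K₁) (Θsp U) ∂ν := by
        congr 1
        funext U
        rw [Function.comp_apply, ← h2 U]
        exact (hΦg (ax U) U).symm
    _ = ∫ U, (Φ ∘ K₁) U ∂ν := integral_comp_eq_of_measurePreserving hΘsp (hΦm.comp hK₁m)
    _ = ∫ U, (Φ ∘ kill) (Θtop U) ∂ν := by
        congr 1
        funext U
        simp only [Function.comp_apply, h3 U]
    _ = ∫ U, (Φ ∘ kill) U ∂ν := integral_comp_eq_of_measurePreserving hΘtop (hΦm.comp hkillm)
    _ = ∫ U, Φ (kill U) ∂ν := rfl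

end Static

end StaticGauge

end Summit.QuantumFields.YangMills.Theorems.AnchorGap

end
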